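import Summits.QuantumFields.BalabanUV.T4Continuum.Spine.NE1p.DressedSmallFieldOnCoresSlot
import Summits.QuantumFields.BalabanUV.T4Continuum.Spine.NE1p.DressedSmallFieldCoresWitness

/-!
# T⁴ programme, spine estimate NE1′ (node O3b/H2) — WITNESS W40 «N0r's SLOT END FIRES WITH A LIVE (2.14) CONTOUR»: the owner's
# `attachedPart_locE_le_of_actOfLetters` (N0r `DressedSmallFieldOnCoresSlot`) APPLIED ONCE BY NAME on a decided `CoreLetters` datum
# whose core IS the substrate's `coreOf = B13TermContourCore.ofContours` — Lebesgue contour parameters `lamJ`, Cauchy weight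
# `wJ (radii κ₁ r)`, contour weight ON the circle `|τ| = 2` — the activity of record `actOfLetters` EVALUATED IN CLOSED FORM
# `cN·√π·(e^{s} − 1)` by row NE5's Cauchy-formula lemma; the attached part `cN·√π·(e − 1) ≠ 0`

Cell `pub-balaban`, sub-cell `t4`, row NE1′ formalisation crew (`t4/formal/NE1p/LEAVES.md` row W40 ∕ DAG N29zw; INTENT HOME/CLAIMS.log
l.17800, BOOKED typer R-T116 (iii) l.17881; owner t4-ne1p-p1 g28 FIRST REFUSAL «GO — NOT MINE» l.17893), unit
`b2b-balaban-t4-ne1p-formalise-leaf-10` (LEAF PROVER 10, gen 9).  ADDITIVE — imports the owner's N0r `Spine/NE1p/DressedSmallFieldOnCoresSlot`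
(⇒ N0q, N0p; the SUBSTRATE cell's `Support/SubstrateActivities` p219669: `CoreLetters`, `coreOf`, `actOfLetters`; row NE5's
`B13TermContourCore` ∕ `B13TermContours`: `ofContours`, `lamJ`, `wJ`, `wB₁`, `integral_w₁_mul_eq_sub`) and this lineage's W33
`Spine/NE1p/DressedSmallFieldCoresWitness` (`E1`, `liveTable` ∕ `VppM_liveTable` ∕ `norm_liveTable_le`, `Acst`, `hsmall_W`, `gaussian_E1`,
`ctr0`, `hroom0`; ⇒ W24 `X₀` ∕ `eq_X₀_iff` ∕ `hrate_torus` ∕ `dressedConst_le_one` ∕ `exp_locE_cube`, row NE5's `toyFrame`) ONLY; toy DATA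
`def`s (+ one bookkeeping `Unique` term, no instance) and theorems; 0 `def … : Prop`, 0 cite, 0 sorry; nothing of N0r ∕ N0q ∕ N0p ∕ the substrate ∕
row NE5 ∕ W24 ∕ W33 restated — their declarations are used BY NAME.

WHY.  N0r §3 `attachedPart_locE_le_of_actOfLetters` hosts the substrate's activity slot of record in N0p's cores END ((B1b)'s `hact` by
`rfl`); faces S29∕S30 and read X131 are booked, but NO decided inhabitant.  W33∕W35 fired N0p §4∕N0q on a `BiCore` with a DIRAC parameter
mass; the substrate's `coreOf ℓ Z j := ofContours …` FORCES the (2.14) contour letters — `lam := lamJ (Jc ⊕ 𝒴)` (Lebesgue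
`dt|_{[0,1]} ⊗ dθ|_{[0,2π]}` per contour variable), `w := wJ (radii κ₁ r)` (Cauchy weight `(2πi)⁻¹((τ − t)²)⁻¹·iτ`), `τ(Y)(p) := sigmaJ …` ON
the circle of radius `r Y`.  THIS FILE is the first inhabitant in which those contour letters are LIVE and EVALUATED:
* §0∕§1 the datum `ℓW` over row NE5's TOY frame — ONE polymer on the circle `r Y := 2 > 1`, NO cube contour (`Jc := PEmpty`: the `κ₁ := 1`
  letter enters `wB` through an EMPTY product — DECLARED idle, like W33's `cons := []`), NE5's DECLARED toy letters `N := cN` (CONSTANT),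
  `q := ‖v‖²`, no χ-constraints, CONSTANT field map `B Y v := 0` (the fluctuation integral is the Gaussian volume `√π`; the table is read
  AT THE ORIGIN through the contour weight); the index `PEmpty ⊕ Unit` has ONE element (`instUniqueIdx`, a `Unique` term used by `letI`, not an instance);
* §2 letters BY NAME: `lam = lamJ`, `lam(univ) = 2π`, `wB = wB₁ 2 = π⁻¹`, `N₁ = 2`, `‖τ p Y‖ = 2`, `chi ≡ 1`, `readOut p v h = circ 2 θ_p·V″(h)(0,0)`;
* §3 CLOSED FORM `termAt_core` ∕ `actOfLetters_closed` ∕ **`actOfLetters_liveTable`**: `actOfLetters ℓW () () o (s • liveTable) = cN·√π·(e^{s} − 1)`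
  — inner Gaussian `√π` (W33 `gaussian_E1`), the one-index `Measure.pi` collapsed to `lam₁` (Mathlib `measurePreserving_funUnique`), then
  row NE5's `integral_w₁_mul_eq_sub` (`∫ w₁ r p·F(circ r p.2) dlam₁ = F 1 − F 0`: Cauchy's formula + FTC in the interpolation parameter);
* §4 `actS N h Z := Σ_{p ∈ termsS N Z} actOfLetters ℓW p.1 p.2 0 h` on `tsys 4 N` — ONE factor on W24's one-cube `X₀` ((B1b)'s residue
  DECIDED); (B3) AS A LETTER BUDGET **`hM3_S` MET**: `2π·(π⁻¹·cN)·(π∕(1∕2))^{1∕2}·e^{2·(0 + 2‖liveTable‖)} = A·e^{−4(1 − ‖liveTable‖)} ≤ A =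
  A₀ + ϱA₁`, `cN := A·e^{−4}∕(2√(2π))`, `A = (e·K₀(64,8)·9·64)⁻¹` (W33 `Acst`), `A₀ := 0`, `A₁ := A∕2`, `ϱ := 2` — TIGHT BY CHOICE (equality
  iff `‖liveTable‖ = 1`), decay factor `1` (`d(X₀) = 0`); `hsmall` = W33 `hsmall_W`, `hrate` = W24 `hrate_torus` BY NAME;
* §5 **`slotEnd_fires`** — N0r §3 ONCE BY NAME at `(tsys 4 N) (tgeometry 4 N)` (N0r's `G`-form; S29's torus face would serve equally — the
  holder's option per R-T116 (iii), not taken: the END OF RECORD itself is the target), `hm`∕`hN`∕`hq` at `(mq, bq, N₀) = (1, 0, cN)`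
  discharged INLINE for the CONSTANT toy letters only (S30 discharges them for the substrate's Gaussian letters of record); conclusion
  LITERAL; `slotEnd_fires_closed : … ≤ 2·K₀(64,8)`;
* §6 GENUINE: `slotAct_one_sub_zero` (`= cN·√π·(e − 1)`), `actS_undressed = 0`, `slotAct_live`, **`slotEnd_live`** (W24 `exp_locE_cube`) + 2 `example`s.

HONEST FRAMING (typer R-T116 (iii) wording (g) + rider ADOPTED).  A DECIDED TOY ([folklore]; 0 sorry; 0 citations; no `def … : Prop` — the
`def`s are toy DATA): N0r §3's slot END applied once BY NAME to ONE `CoreLetters` datum over row NE5's toy frame — the substrate's FORMAT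
(`coreOf = ofContours`, `actOfLetters`) with NE5's DECLARED toy letters `N := const`, `q := ‖v‖²`, constant field map; the LIVE object is
OUR decided contour datum in the substrate's FORMAT, evaluated through row NE5's lemma by Mathlib's Cauchy integral formula and Gaussian
integral — NOT Bałaban's (2.14) contour representation of a resummed activity, whose identification (B1b) is NOT claimed; `cN` is CHOSEN
so that (B3)'s letter-mass clause holds with equality — (B3) = G-ne9p2-5 stays UNPRINTED for Bałaban's cores; `2`, `2π`, `π⁻¹`, `√π`,
`e − 1`, `e^{−4}` are OUR toy arithmetic — no numeral of [Balaban1988RGII]; (B1b)'s residue (`terms`∕`emb`∕`hscale`) is BY DEFINITION of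
the toy; the operator-letter blocks are discharged for CONSTANT toy letters only; 0 binders instantiated on Bałaban's densities; no wall
item; wall v1.7 (T4-DAG v42) does NOT move; R-t4r2-Q2 NOT met thereby; NE1′ ⇐ the named binders — NOT proved, NOT printed; spine PROVED
0∕9; count 9 unchanged.  Rung (B)+1 on ONE finite four-torus — NOT infinite volume, NOT a mass gap, NOT OS on ℝ⁴, NOT Clay.  HONEST
DEPENDENCY: continuum YM on T⁴ ⇐ BetaPertH ∧ nine spine estimates (0/9 proved); BetaPertH ⇐ (D1) ∧ (D4) ∧ CAP+tail; G-an2-4 gates asym,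
D1 and NE2/3/4.
-/

noncomputable section

namespace Summit.QuantumFields.BalabanUV.T4Continuum.NE1p.DressedSmallFieldSlotWitness

open Set Metric MeasureTheory Complex
open scoped BigOperators
open Literature.MathematicalPhysics.QuantumFieldTheory.Balaban1983to89
open Literature.MathematicalPhysics.QuantumFieldTheory.Balaban1983to89.B12TreeDecay (K₀ K₀_pos)
open Literature.MathematicalPhysics.QuantumFieldTheory.Balaban1983to89.B13Resummation (locE)
open Literature.MathematicalPhysics.QuantumFieldTheory.Balaban1983to89.TreeLengthTorus (TDom tsys torusTreeLen torusTreeLen_singleton)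
open Literature.MathematicalPhysics.QuantumFieldTheory.Balaban1983to89.TreeLengthTorusGeometry (tgeometry TTouch)
open Summit.QuantumFields.BalabanUV.T4Continuum.B13HistDatum (level136)
open Summit.QuantumFields.BalabanUV.T4Continuum.B13HistMeasurable (B13HistM)
open Summit.QuantumFields.BalabanUV.T4Continuum.B13HistReadout (VppCLMM VppCLMM_apply)
open Summit.QuantumFields.BalabanUV.T4Continuum.B13HistWitness (toyFrame level136_toyFrame)
open Summit.QuantumFields.BalabanUV.T4Continuum.B13TermParamGaussianBi (BiCore)
open Summit.QuantumFields.BalabanUV.T4Continuum.B13TermContours (lam₁ w₁ wB₁ circ lamJ wJ wBJ radii sigmaJ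
  integral_w₁_mul_eq_sub)
open Summit.QuantumFields.BalabanUV.T4Continuum.B13TermContourCore (ofContours wB_ofContours N₁_ofContours norm_τ_ofContours)
open Summit.QuantumFields.BalabanUV.T4Continuum.SubstrateActivities (CoreLetters coreOf actOfLetters actOfLetters_apply)
open Summit.QuantumFields.BalabanUV.T4Continuum.InsertionLinearClass (linToyCarriers)
open Summit.QuantumFields.BalabanUV.T4Continuum.NE1p.DressedSmallFieldOnCoresSlot (attachedPart_locE_le_of_actOfLetters)
open Summit.QuantumFields.BalabanUV.T4Continuum.NE1p.DressedSmallFieldCoresWitness (E1 liveTable VppM_liveTable norm_liveTable_le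
  Acst Acst_pos hsmall_W gaussian_E1 integrable_gauss_E1_cexp ctr0 hroom0)
open Summit.QuantumFields.BalabanUV.T4Continuum.NE1p.DressedSmallFieldTorusWitness (X₀ X₀_val eq_X₀_iff hrate_torus
  dressedConst_le_one exp_locE_cube)
open Summit.QuantumFields.BalabanUV.T4Continuum.NE1p.DressedSmallFieldGeometry (torus_consts)
open Summit.QuantumFields.BalabanUV.T4Continuum.NE1p.DressedSmallFieldGeometryFaces (K₀_four)

/-! ## §0 The one contour index: no cube contour, ONE polymer -/
/-- The (2.14) parameter index of the toy factor is `Jc ⊕ 𝒴 = PEmpty ⊕ Unit` — exactly ONE contour variable (toy bookkeeping: a `Unique`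
STRUCTURE TERM supplied by `letI` inside the three proofs that collapse the index; NOT an instance, nothing is exported). [folklore] -/
@[reducible] def instUniqueIdx : Unique (PEmpty.{1} ⊕ Unit) where
  default := Sum.inr ()
  uniq := fun x => by rcases x with ⟨⟨⟩⟩ | ⟨⟨⟩⟩; rfl

/-! ## §1 The letter record (toy DATA) -/
/-- Polymer-family types per factor: ONE polymer `Y` (toy DATA). [folklore] -/
abbrev Yf : Unit → Unit → Type := fun _ _ => Unit
/-- … sitting at the toy carrier domain `0` (toy DATA). [folklore] -/
abbrev domf : ∀ Z j, Yf Z j → ℕ := fun _ _ _ => 0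
/-- Cube index per factor: NO cube contour (toy DATA; the `κ₁` letter then enters `wB` through an empty product only). [folklore] -/
abbrev Jcf : Unit → Unit → Type := fun _ _ => PEmpty.{1}
/-- Flat fluctuation space per factor: one real Gaussian variable (NE5's `E1` convention, via W33). [folklore] -/
abbrev Vf : Unit → Unit → Type := fun _ _ => E1
/-- THE NORMALISATION LETTER (toy DATA): the constant `cN := A·e^{−4}∕(2√(2π))`, `A = (e·K₀(64,8)·9·64)⁻¹` W24's located constant
(W33's `Acst` BY NAME); chosen so that the (2.38)-letter budget is met with equality at `‖liveTable‖ = 1` (TIGHT BY CHOICE). [folklore] -/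
def cN : ℝ := Acst * Real.exp (-4) / (2 * Real.sqrt (2 * Real.pi))
/-- `0 < cN`. [folklore] -/
theorem cN_pos : 0 < cN := by
  unfold cN; have := Acst_pos; have : 0 < Real.sqrt (2 * Real.pi) := Real.sqrt_pos.2 (by positivity); positivity
/-- **THE LETTER RECORD** (toy DATA) [decided toy]: cube-contour letter `κ₁ := 1` (idle: `Jc = ∅`), (2.18) radius `r Y := 2 > 1`, Gaussian
letters `N := cN` (constant), `q := ‖v‖²`, no χ-constraints, sign exponent `0`, CONSTANT field map `B Y v := 0` — so the fluctuation
integral is the Gaussian volume and the table is read AT THE ORIGIN through the contour weight `τ(Y) = circ 2 θ`.  Not Bałaban's data,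
not the substrate's letters of record. [folklore] -/
def ℓW : ∀ (Z : Unit) (j : Unit), CoreLetters toyFrame ℂ Yf domf Jcf Vf Z j := fun _ _ =>
  { κ₁ := 1
    κ₁_pos := one_pos
    r := fun _ => 2
    one_lt_r := fun _ => by norm_num
    N := fun _ _ => (cN : ℂ)
    q := fun _ _ v => ((‖v‖ ^ 2 : ℝ) : ℂ)
    cons := []
    nsign := 0
    B := fun _ _ => (0 : ℝ)
    measB := fun _ => measurable_const }

/-! ## §2 The letters of its core `coreOf ℓW = ofContours …` BY NAME -/
/-- The parameter measure IS row NE5's `lamJ` on the one-variable index (`rfl`). [folklore] -/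
theorem lam_core : (coreOf toyFrame ℂ Yf domf Jcf Vf ℓW () ()).lam = lamJ (PEmpty.{1} ⊕ Unit) := rfl
/-- `lam₁(univ) = |[0,1]|·|[0,2π]| = 2π`. [folklore] -/
theorem lam₁_real_univ : lam₁.real univ = 2 * Real.pi := by
  unfold Measure.real lam₁
  rw [← univ_prod_univ, Measure.prod_prod, Measure.restrict_apply_univ, Measure.restrict_apply_univ, Real.volume_Icc,
    Real.volume_Icc, sub_zero, sub_zero, ENNReal.toReal_mul, ENNReal.toReal_ofReal zero_le_one,
    ENNReal.toReal_ofReal (by positivity), one_mul]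
/-- **THE PARAMETER VOLUME** `lam(univ) = 2π` (ONE contour variable). [folklore] -/
theorem lam_real_univ : (coreOf toyFrame ℂ Yf domf Jcf Vf ℓW () ()).lam.real univ = 2 * Real.pi := by
  letI := instUniqueIdx
  rw [lam_core]
  unfold Measure.real
  rw [lamJ, Measure.pi_univ, Fintype.prod_unique]
  exact lam₁_real_univ
/-- **THE WEIGHT LETTER** `wB = wB₁ 2 = π⁻¹` (`wB_ofContours` BY NAME: empty cube product × one polymer factor). [folklore] -/
theorem wB_core : (coreOf toyFrame ℂ Yf domf Jcf Vf ℓW () ()).wB = Real.pi⁻¹ := by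
  unfold coreOf
  rw [wB_ofContours, Fintype.prod_empty, one_mul, Fintype.prod_unique]
  show wB₁ 2 = Real.pi⁻¹
  unfold wB₁; have := Real.pi_pos; field_simp; norm_num
/-- **THE READ-OUT LETTER** `N₁ = Σ_Y r Y·level136 = 2` (`N₁_ofContours` BY NAME, toy frame's unit (1.36)-weight). [folklore] -/
theorem N₁_core : (coreOf toyFrame ℂ Yf domf Jcf Vf ℓW () ()).N₁ = 2 := by
  unfold coreOf
  rw [N₁_ofContours, Fintype.sum_unique]
  show (2 : ℝ) * level136 toyFrame.consts (linToyCarriers.d 0) = 2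
  rw [level136_toyFrame, mul_one]
/-- The contour weight LIVES ON THE CIRCLE `|τ| = 2` (`norm_τ_ofContours` BY NAME). [folklore] -/
theorem norm_τ_core (p : (PEmpty.{1} ⊕ Unit) → ℝ × ℝ) : ‖(coreOf toyFrame ℂ Yf domf Jcf Vf ℓW () ()).τ p ()‖ = 2 :=
  norm_τ_ofContours _ _ _ _ _ _ _ _ p ()
/-- No χ-constraints: the potential-free factor is `1`. [folklore] -/
theorem chi_core (v : E1) : (coreOf toyFrame ℂ Yf domf Jcf Vf ℓW () ()).chi v = 1 := by
  unfold BiCore.chi BiCore.chiSet; simp [coreOf, ofContours, ℓW]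
/-- **THE READ-OUT READS THE TABLE AT THE ORIGIN THROUGH THE CONTOUR**: `readOut p v h = circ 2 θ_p · V″(h)(0, 0)`. [folklore] -/
theorem readOut_core (p : (PEmpty.{1} ⊕ Unit) → ℝ × ℝ) (v : E1) (h : B13HistM toyFrame) :
    (coreOf toyFrame ℂ Yf domf Jcf Vf ℓW () ()).readOut p v h = circ 2 (p (Sum.inr ())).2 * toyFrame.VppM h 0 (0 : ℝ) := by
  rw [BiCore.readOut_apply]
  show ∑ Y ∈ (Finset.univ : Finset Unit), sigmaJ (radii (Jc := PEmpty.{1}) (1 : ℝ) (fun _ : Unit => (2 : ℝ))) p (Sum.inr Y) * _ = _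
  rw [Finset.univ_unique, Finset.sum_singleton]
  rfl

/-! ## §3 THE ACTIVITY OF RECORD IN CLOSED FORM: Gaussian volume, `Measure.pi` collapsed, Cauchy + FTC (row NE5 BY NAME) -/
/-- The fluctuation integral is the Gaussian volume: `∫ chi·e^{x}·e^{−‖v‖²} dv = e^{x}·√π` (Mathlib's Gaussian via W33's `gaussian_E1`). [folklore] -/
theorem inner_core (x : ℂ) (o : ℂ) (p : (PEmpty.{1} ⊕ Unit) → ℝ × ℝ) :
    ∫ v : E1, (coreOf toyFrame ℂ Yf domf Jcf Vf ℓW () ()).chi v * cexp x *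
        cexp (-(coreOf toyFrame ℂ Yf domf Jcf Vf ℓW () ()).q o p v) = cexp x * (Real.sqrt Real.pi : ℂ) := by
  simp_rw [chi_core, one_mul]
  show ∫ v : E1, cexp x * cexp (-(((‖v‖ ^ 2 : ℝ) : ℂ))) = _
  rw [integral_const_mul]
  congr 1
  have h : ∀ v : E1, cexp (-(((‖v‖ ^ 2 : ℝ) : ℂ))) = ((Real.exp (-‖v‖ ^ 2) : ℝ) : ℂ) := fun v => by
    rw [← Complex.ofReal_neg, ← Complex.ofReal_exp]
  simp_rw [h]
  rw [integral_complex_ofReal, gaussian_E1]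
/-- The product Cauchy weight over the one-variable index IS the one-variable weight at radius `2`. [folklore] -/
theorem wJ_core (p : (PEmpty.{1} ⊕ Unit) → ℝ × ℝ) :
    wJ (radii (Jc := PEmpty.{1}) (1 : ℝ) (fun _ : Unit => (2 : ℝ))) p = w₁ 2 (p (Sum.inr ())) := by
  letI := instUniqueIdx; unfold wJ; rw [Fintype.prod_unique]; rfl
/-- **THE TERM IN CLOSED FORM** [decided toy]: `termAt o h = cN·√π·(e^{V″(h)(0,0)} − 1)` — the inner Gaussian is `√π`, the one-index
`Measure.pi` collapses to `lam₁` (`measurePreserving_funUnique`), and row NE5's `integral_w₁_mul_eq_sub` (Cauchy's formula for the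
derivative + the fundamental theorem of calculus in the interpolation parameter) evaluates `∫ w₁ 2 p·F(circ 2 p.2) dlam₁ = F 1 − F 0`
at the entire `F τ := cN·(e^{τ·V″(h)(0,0)}·√π)`. [folklore] -/
theorem termAt_core (o : ℂ) (h : B13HistM toyFrame) :
    (coreOf toyFrame ℂ Yf domf Jcf Vf ℓW () ()).termAt o h =
      (cN : ℂ) * (Real.sqrt Real.pi : ℂ) * (cexp (toyFrame.VppM h 0 (0 : ℝ)) - 1) := by
  letI := instUniqueIdx
  set c : ℂ := toyFrame.VppM h 0 (0 : ℝ) with hc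
  unfold BiCore.termAt
  simp_rw [readOut_core, inner_core]
  show ∫ p, wJ (radii (Jc := PEmpty.{1}) (1 : ℝ) (fun _ : Unit => (2 : ℝ))) p * (cN : ℂ) *
      (cexp (circ 2 (p (Sum.inr ())).2 * c) * (Real.sqrt Real.pi : ℂ)) ∂(lamJ (PEmpty.{1} ⊕ Unit)) = _
  simp_rw [wJ_core, mul_assoc]
  have hmp := measurePreserving_funUnique lam₁ (PEmpty.{1} ⊕ Unit)
  have key : ∫ p, w₁ 2 (p (Sum.inr ())) * ((cN : ℂ) * (cexp (circ 2 (p (Sum.inr ())).2 * c) * (Real.sqrt Real.pi : ℂ)))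
      ∂(lamJ (PEmpty.{1} ⊕ Unit)) =
      ∫ y, w₁ 2 y * ((cN : ℂ) * (cexp (circ 2 y.2 * c) * (Real.sqrt Real.pi : ℂ))) ∂lam₁ :=
    hmp.integral_comp' (fun y : ℝ × ℝ => w₁ 2 y * ((cN : ℂ) * (cexp (circ 2 y.2 * c) * (Real.sqrt Real.pi : ℂ))))
  rw [key]
  have hF : DifferentiableOn ℂ (fun τ : ℂ => (cN : ℂ) * (cexp (τ * c) * (Real.sqrt Real.pi : ℂ))) univ := by
    apply Differentiable.differentiableOn; fun_prop
  rw [integral_w₁_mul_eq_sub (r := 2) (by norm_num) isOpen_univ (subset_univ _) hF]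
  simp only [one_mul, zero_mul, Complex.exp_zero]
  ring
/-- **THE ACTIVITY OF RECORD IN CLOSED FORM**: `actOfLetters ℓW () () o h = cN·√π·(e^{V″(h)(0,0)} − 1)` (`actOfLetters_apply` BY NAME). [folklore] -/
theorem actOfLetters_closed (o : ℂ) (h : B13HistM toyFrame) :
    actOfLetters toyFrame ℂ Yf domf Jcf Vf ℓW () () o h = (cN : ℂ) * (Real.sqrt Real.pi : ℂ) * (cexp (toyFrame.VppM h 0 (0 : ℝ)) - 1) := by
  rw [actOfLetters_apply]; exact termAt_core o h
/-- The table-blind table reads `0` (the read-out is LINEAR in the table: `VppCLMM` BY NAME). [folklore] -/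
theorem VppM_zero : toyFrame.VppM (0 : B13HistM toyFrame) 0 (0 : ℝ) = 0 := by
  rw [← VppCLMM_apply, map_zero]
/-- Along the table pencil `s • liveTable` the origin reads `s·e^{−0²} = s` (linearity + W33's `VppM_liveTable`). [folklore] -/
theorem VppM_smul_liveTable (s : ℂ) : toyFrame.VppM (s • liveTable) 0 (0 : ℝ) = s := by
  rw [← VppCLMM_apply, map_smul, VppCLMM_apply, VppM_liveTable, smul_eq_mul]; simp
/-- **THE ACTIVITY OF RECORD ALONG THE TABLE PENCIL IN CLOSED FORM**: `actOfLetters ℓW () () o (s • liveTable) = cN·√π·(e^{s} − 1)` —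
the `e^{s}` is the contour's value at the interpolation end `t = 1`, the `− 1` its value at `t = 0`. [folklore] -/
theorem actOfLetters_liveTable (o s : ℂ) :
    actOfLetters toyFrame ℂ Yf domf Jcf Vf ℓW () () o (s • liveTable) = (cN : ℂ) * (Real.sqrt Real.pi : ℂ) * (cexp s - 1) := by
  rw [actOfLetters_closed, VppM_smul_liveTable]
/-- AT THE TABLE-BLIND TABLE THE ACTIVITY VANISHES: `F 1 − F 0 = 0` for the constant `F` — the interpolation difference is real. [folklore] -/
example (o : ℂ) : actOfLetters toyFrame ℂ Yf domf Jcf Vf ℓW () () o 0 = 0 := by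
  rw [actOfLetters_closed, VppM_zero, Complex.exp_zero, sub_self, mul_zero]
/-- The dressed table `0 + liveTable` reads `e^{−0²} = 1` at the origin (W33's `VppM_liveTable`, a THEOREM of the constructor). [folklore] -/
theorem VppM_dressed : toyFrame.VppM ((0 : B13HistM toyFrame) + liveTable) 0 (0 : ℝ) = 1 := by
  rw [zero_add, VppM_liveTable]; simp

/-! ## §4 The slot activities on the periodic carrier `tsys 4 N` (toy DATA) and the sockets of N0r §3 -/

section Torus
variable (N : ℕ) [NeZero N]

open Classical in
/-- (B1b)'s residue, DECIDED: ONE factor `((), ())` on W24's one-cube domain `X₀`, none elsewhere (toy DATA). [folklore] -/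
def termsS (Z : TDom 4 N) : Finset (Unit × Unit) := if Z.1 = {0} then {((), ())} else ∅
/-- On `X₀` there is exactly the one factor. [folklore] -/
theorem termsS_X₀ : termsS N (X₀ N) = {((), ())} := by unfold termsS; rw [if_pos (X₀_val N)]
/-- THE SUMMED SLOT ACTIVITY at operator datum `0` and table `h` (toy DATA) — LITERALLY the function N0r §3's END bounds:
`Z ↦ Σ_{p ∈ terms Z} actOfLetters ℓW p.1 p.2 0 h`. [folklore] -/
def actS (h : B13HistM toyFrame) (Z : TDom 4 N) : ℂ := ∑ p ∈ termsS N Z, actOfLetters toyFrame ℂ Yf domf Jcf Vf ℓW p.1 p.2 (0 : ℂ) h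
/-- The letter mass of the one factor at the pencil radius `ϱ = 2`: `2π·(π⁻¹·cN·e⁰)·(π∕(1∕2))^{1∕2} = A·e^{−4}`. [folklore] -/
theorem letterMass_eq :
    2 * Real.pi * (Real.pi⁻¹ * cN * Real.exp 0) * (Real.pi / (1 / 2)) ^ ((1 : ℝ) / 2) = Acst * Real.exp (-4) := by
  have hπ := Real.pi_pos
  have hs : 0 < Real.sqrt (2 * Real.pi) := Real.sqrt_pos.2 (by positivity)
  rw [show Real.pi / (1 / 2) = 2 * Real.pi by ring, ← Real.sqrt_eq_rpow, Real.exp_zero, mul_one]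
  unfold cN
  field_simp
/-- **(B3) AS A LETTER BUDGET `hM3` — MET AT `X₀`** [decided toy]: a domain inside `X₀` IS `X₀` (W24 `eq_X₀_iff`); there the one factor's
letter mass times the table growth `e^{N₁·(‖0‖ + 2‖liveTable‖)} = e^{4‖liveTable‖}` is `A·e^{−4(1 − ‖liveTable‖)} ≤ A = A₀ + ϱA₁`
(`A₀ := 0`, `A₁ := A∕2`, `ϱ := 2`; decay factor `1` since `d(X₀) = 0`; TIGHT iff `‖liveTable‖ = 1`). [folklore] -/
theorem hM3_S (k : ℕ) (R : ℝ) :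
    ∀ Z : (tsys 4 N).Dom, (tgeometry 4 N).cubes Z ⊆ (tgeometry 4 N).cubes (X₀ N) →
      ∑ p ∈ termsS N Z, (coreOf toyFrame ℂ Yf domf Jcf Vf ℓW p.1 p.2).lam.real univ *
          ((coreOf toyFrame ℂ Yf domf Jcf Vf ℓW p.1 p.2).wB * (fun (_ : ℕ) (_ : Unit × Unit) (_ : ℕ) => cN) k p k *
            Real.exp ((fun (_ : ℕ) (_ : Unit × Unit) (_ : ℕ) => (0 : ℝ)) k p k)) *
          (Real.pi / ((fun (_ : ℕ) (_ : Unit × Unit) (_ : ℕ) => (1 : ℝ)) k p k / 2)) ^ (Module.finrank ℝ (Vf p.1 p.2) / 2 : ℝ) *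
        Real.exp ((coreOf toyFrame ℂ Yf domf Jcf Vf ℓW p.1 p.2).N₁ * (‖(0 : B13HistM toyFrame)‖ + 2 * ‖liveTable‖)) ≤
      (0 + 2 * (Acst / 2)) * Real.exp (-(R * (tsys 4 N).dj Z)) := by
  intro Z hZ
  have hZX : Z = X₀ N := (eq_X₀_iff N Z).1 ((Finset.Nonempty.subset_singleton_iff Z.2.1).1 hZ)
  subst hZX
  rw [termsS_X₀, Finset.sum_singleton]
  simp only []
  rw [lam_real_univ, wB_core, N₁_core, norm_zero, zero_add, finrank_euclideanSpace, Fintype.card_fin, Nat.cast_one, letterMass_eq]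
  have hd : (tsys 4 N).dj (X₀ N) = 0 := by show torusTreeLen (X₀ N).1 = 0; rw [X₀_val]; exact torusTreeLen_singleton 0
  rw [hd, mul_zero, neg_zero, Real.exp_zero, mul_one]
  have hT : ‖liveTable‖ ≤ 1 := norm_liveTable_le
  calc Acst * Real.exp (-4) * Real.exp (2 * (2 * ‖liveTable‖))
      = Acst * Real.exp (-4 + 2 * (2 * ‖liveTable‖)) := by rw [mul_assoc, ← Real.exp_add]
    _ ≤ Acst * Real.exp 0 := by
        gcongr
        · exact Acst_pos.le
        · linarith
    _ = 0 + 2 * (Acst / 2) := by rw [Real.exp_zero]; ring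

/-! ## §5 THE END FIRES: N0r §3 `attachedPart_locE_le_of_actOfLetters` applied ONCE BY NAME -/

open Classical in
/-- **N0r's SLOT END FIRES ON THE LIVE-CONTOUR DATUM** [decided toy]: `attachedPart_locE_le_of_actOfLetters toyFrame ℂ Yf domf Jcf Vf
(tsys 4 N) (tgeometry 4 N) ℓW` with W33's centres `ctr0` and room `hroom0`, the operator-letter blocks `hm`∕`hN`∕`hq` at
`(mq, bq, N₀) = (1, 0, cN)` discharged INLINE for the CONSTANT toy letters (a.e.-measurability w.r.t. `lamJ`, holomorphy of constants,
`‖cN‖ ≤ cN`, margin `1·‖v‖² − 0 ≤ Re ‖v‖²`), the two class-radius inequalities, `hscale` by `rfl`, `terms := termsS`, W24's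
`hrate_torus`, W33's `hsmall_W`, `hM3_S`, `hϱ : 2 ≤ 2`, `hϱA`.  Conclusion LITERAL (`actS N h` IS `fun Z => Σ_{p ∈ termsS N Z}
actOfLetters … p.1 p.2 0 h` by definition).  Nothing of Bałaban's densities. [folklore] -/
theorem slotEnd_fires (k : ℕ) :
    ‖locE (tgeometry 4 N).ι (tgeometry 4 N).cubes (actS N ((0 : B13HistM toyFrame) + liveTable)) ((tgeometry 4 N).cubes (X₀ N)) -
        locE (tgeometry 4 N).ι (tgeometry 4 N).cubes (actS N 0) ((tgeometry 4 N).cubes (X₀ N))‖ ≤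
      4 * (Real.exp 1 * (tgeometry 4 N).ν * (tgeometry 4 N).c₁ * (tgeometry 4 N).K₀ ^ 2) * (Acst / 2) *
        Real.exp (-(0 * (tsys 4 N).dj (X₀ N))) :=
  attachedPart_locE_le_of_actOfLetters toyFrame ℂ Yf domf Jcf Vf (tsys 4 N) (tgeometry 4 N) ℓW
    (W := Set.univ) (ctr := ctr0) (ROp := fun _ => 1) (RHist := fun _ => 2) (R' := fun _ => 2)
    (mq := fun _ _ _ => 1) (bq := fun _ _ _ => 0) (N₀ := fun _ _ _ => cN)
    hroom0 (fun _ _ _ _ _ _ _ => one_pos)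
    (fun _ _ _ _ _ _ _ => ⟨fun _ _ => aestronglyMeasurable_const, fun _ => differentiableOn_const _, fun _ _ _ => by
      show ‖(cN : ℂ)‖ ≤ cN; rw [Complex.norm_real, Real.norm_eq_abs, abs_of_pos cN_pos]⟩)
    (fun _ _ _ _ _ _ _ => ⟨fun _ _ => (Complex.measurable_ofReal.comp (measurable_snd.norm.pow_const 2)).aestronglyMeasurable,
      fun _ _ => differentiableOn_const _, fun _ _ _ v => by
        show 1 * ‖v‖ ^ 2 - 0 ≤ (((‖v‖ ^ 2 : ℝ) : ℂ)).re; rw [Complex.ofReal_re]; simp⟩)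
    (k := k) (g := fun _ => 0) (Set.mem_univ _) (U := ()) (o := 0) (h₀ := 0) (w := liveTable) (ϱ := 2)
    (by show ‖(0 : ℂ) - 0‖ ≤ 1; simp)
    (by show ‖(0 : B13HistM toyFrame) - 0‖ + 2 * ‖liveTable‖ ≤ 2; rw [sub_zero, norm_zero, zero_add];
        linarith [norm_liveTable_le])
    (emb := fun _ => k) (fun _ => rfl) (termsS N)
    (A₀ := 0) (A₁ := Acst / 2) (R := 2 * (tgeometry 4 N).κ₀ + 2) (r₁ := 0) (b₅ := 0) (X₀ := X₀ N)
    le_rfl (by have := Acst_pos; positivity) le_rfl (by norm_num) (hrate_torus N) (hsmall_W N) (hM3_S N k _)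
    le_rfl (by have := Acst_pos; linarith)

open Classical in
/-- … in CLOSED FORM: `≤ 4·(e·9·64·K₀(64,8)²)·(A∕2) = 2·K₀(64,8)` (pv22's constants by `torus_consts`∕`K₀_four` BY NAME). [folklore] -/
theorem slotEnd_fires_closed (k : ℕ) :
    ‖locE (tgeometry 4 N).ι (tgeometry 4 N).cubes (actS N ((0 : B13HistM toyFrame) + liveTable)) ((tgeometry 4 N).cubes (X₀ N)) -
        locE (tgeometry 4 N).ι (tgeometry 4 N).cubes (actS N 0) ((tgeometry 4 N).cubes (X₀ N))‖ ≤ 2 * K₀ 64 8 := by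
  refine (slotEnd_fires N k).trans (le_of_eq ?_)
  rw [(torus_consts N).1, (torus_consts N).2.2, K₀_four, zero_mul, neg_zero, Real.exp_zero, mul_one]
  unfold Acst
  have hK := K₀_pos (64 : ℝ) 8
  have he := Real.exp_pos 1
  field_simp
  ring

/-! ## §6 GENUINE: the contour is live — the attached part is `cN·√π·(e − 1) ≠ 0`, and the END's bounded quantity is NOT zero -/
/-- `cN·√π = A·e^{−4}∕(2√2)` (`√(2π) = √2·√π`). [folklore] -/
theorem cN_mul_sqrt_pi : cN * Real.sqrt Real.pi = Acst * Real.exp (-4) / (2 * Real.sqrt 2) := by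
  unfold cN
  have hπ : 0 < Real.sqrt Real.pi := Real.sqrt_pos.2 Real.pi_pos
  have h2 : 0 < Real.sqrt 2 := Real.sqrt_pos.2 (by norm_num)
  rw [Real.sqrt_mul (by norm_num : (0 : ℝ) ≤ 2)]
  field_simp
/-- **THE ATTACHED PART OF THE SLOT ACTIVITY AT `X₀` IN CLOSED FORM**: `act(0 + liveTable) − act(0) = cN·√π·(e − 1)`. [folklore] -/
theorem slotAct_one_sub_zero :
    actS N ((0 : B13HistM toyFrame) + liveTable) (X₀ N) - actS N 0 (X₀ N) = (cN : ℂ) * (Real.sqrt Real.pi : ℂ) * (cexp 1 - 1) := by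
  unfold actS
  rw [termsS_X₀, Finset.sum_singleton, Finset.sum_singleton, actOfLetters_closed, actOfLetters_closed, VppM_dressed, VppM_zero,
    Complex.exp_zero, sub_self, mul_zero, sub_zero]
/-- The undressed slot activity VANISHES (`F 1 − F 0` of a constant `F`): the interpolation difference is real. [folklore] -/
theorem actS_undressed : actS N (0 : B13HistM toyFrame) (X₀ N) = 0 := by
  unfold actS
  rw [termsS_X₀, Finset.sum_singleton, actOfLetters_closed, VppM_zero, Complex.exp_zero, sub_self, mul_zero]
/-- The dressed slot activity is the positive real `A·e^{−4}(e − 1)∕(2√2)`. [folklore] -/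
theorem actS_dressed : actS N ((0 : B13HistM toyFrame) + liveTable) (X₀ N) =
    ((Acst * Real.exp (-4) / (2 * Real.sqrt 2) * (Real.exp 1 - 1) : ℝ) : ℂ) := by
  have h := slotAct_one_sub_zero N
  rw [actS_undressed, sub_zero] at h
  rw [h, ← Complex.ofReal_mul, cN_mul_sqrt_pi, ← Complex.ofReal_one, ← Complex.ofReal_exp, ← Complex.ofReal_sub,
    ← Complex.ofReal_mul]
/-- `0 < A·e^{−4}(e − 1)∕(2√2) < 1` (`A ≤ 1` is W24's `dressedConst_le_one`; `e^{−4}(e − 1) = e^{−3} − e^{−4} < 1`). [folklore] -/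
theorem dressed_value_pos_lt_one :
    0 < Acst * Real.exp (-4) / (2 * Real.sqrt 2) * (Real.exp 1 - 1) ∧
      Acst * Real.exp (-4) / (2 * Real.sqrt 2) * (Real.exp 1 - 1) < 1 := by
  have hA := Acst_pos
  have hA1 : Acst ≤ 1 := dressedConst_le_one
  have h2 : 1 ≤ Real.sqrt 2 := by rw [show (1 : ℝ) = Real.sqrt 1 from Real.sqrt_one.symm]; exact Real.sqrt_le_sqrt (by norm_num)
  have he1 : 1 < Real.exp 1 := Real.one_lt_exp_iff.2 one_pos
  have he : Real.exp (-4) * (Real.exp 1 - 1) < 1 := by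
    have : Real.exp (-4) * Real.exp 1 = Real.exp (-3) := by rw [← Real.exp_add]; norm_num
    have h3 : Real.exp (-3) < 1 := Real.exp_lt_one_iff.2 (by norm_num)
    nlinarith [Real.exp_pos (-4)]
  refine ⟨by positivity, ?_⟩
  rw [div_mul_eq_mul_div, div_lt_one (by positivity)]
  calc Acst * Real.exp (-4) * (Real.exp 1 - 1) ≤ 1 * (Real.exp (-4) * (Real.exp 1 - 1)) := by
        rw [mul_assoc]; exact mul_le_mul_of_nonneg_right hA1 (by nlinarith [Real.exp_pos (-4)])
    _ < 1 * 1 := by rw [one_mul, one_mul]; exact he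
    _ ≤ 2 * Real.sqrt 2 := by linarith
/-- **THE ATTACHED PART IS NOT ZERO** — the contour is LIVE. [folklore] -/
theorem slotAct_live : actS N ((0 : B13HistM toyFrame) + liveTable) (X₀ N) ≠ actS N 0 (X₀ N) := by
  rw [actS_dressed, actS_undressed, Ne, Complex.ofReal_eq_zero]
  exact (dressed_value_pos_lt_one).1.ne'
/-- Both pencil ends are STRICTLY inside the unit disc (so W24's `exp_locE_cube` applies). [folklore] -/
theorem norm_actS_lt_one :
    ‖actS N ((0 : B13HistM toyFrame) + liveTable) (X₀ N)‖ < 1 ∧ ‖actS N (0 : B13HistM toyFrame) (X₀ N)‖ < 1 := by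
  refine ⟨?_, by rw [actS_undressed, norm_zero]; exact one_pos⟩
  rw [actS_dressed, Complex.norm_real, Real.norm_eq_abs, abs_of_pos (dressed_value_pos_lt_one).1]
  exact (dressed_value_pos_lt_one).2

open Classical in
/-- **THE BOUNDED QUANTITY OF THE END IS NOT ZERO** [decided toy]: the dressed small-field outputs of the slot activities at the dressed
table `0 + liveTable` and at the undressed table `0` DIFFER on the cube — W24's `exp_locE_cube` BY NAME turns equal outputs into equal
activities at `X₀`, contradicting `slotAct_live`. [folklore] -/
theorem slotEnd_live :
    locE (tgeometry 4 N).ι (tgeometry 4 N).cubes (actS N ((0 : B13HistM toyFrame) + liveTable)) ((tgeometry 4 N).cubes (X₀ N)) ≠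
      locE (tgeometry 4 N).ι (tgeometry 4 N).cubes (actS N 0) ((tgeometry 4 N).cubes (X₀ N)) := by
  intro h
  have h1 := exp_locE_cube N (w := actS N ((0 : B13HistM toyFrame) + liveTable)) (norm_actS_lt_one N).1
  have h0 := exp_locE_cube N (w := actS N 0) (norm_actS_lt_one N).2
  have h' : cexp (locE (TTouch (d := 4) (N := N)) (fun Z : (tsys 4 N).Dom => Z.1) (actS N ((0 : B13HistM toyFrame) + liveTable)) {0}) =
      cexp (locE (TTouch (d := 4) (N := N)) (fun Z : (tsys 4 N).Dom => Z.1) (actS N 0) {0}) := congrArg cexp h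
  rw [h1, h0, add_right_inj] at h'
  exact slotAct_live N h'
/-- THE CONTOUR LETTER IS NOT DECORATION: its weight has modulus EXACTLY the (2.18) radius `2` at every parameter. [folklore] -/
example (p : (PEmpty.{1} ⊕ Unit) → ℝ × ℝ) : ‖(coreOf toyFrame ℂ Yf domf Jcf Vf ℓW () ()).τ p ()‖ = 2 := norm_τ_core p

end Torus

end Summit.QuantumFields.BalabanUV.T4Continuum.NE1p.DressedSmallFieldSlotWitness
end
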